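import Summits.ValiantsHypothesis.ValiantsHypothesis.Theorems.BarrierLeverPartitionMinorsHitByVPHiddenStatesCoreFree

/-!
# Route BarrierLever — item `PartitionMinorsHitByVP` (stmt-ValiantsHypothesis-19717), line `hidden_states`:
# the STRONG ADD-ROW LEMMA — a free point absorbs an ARBITRARY row (no maximality condition)

Helper file (`--supports stmt-ValiantsHypothesis-19717`; cell valiant-natproofs, rung V4, 𝒟-side door (c); prover seat val-np-p6 gen 9).
One bookkeeping `def` (`curveShift`). Closes NO item. Strengthens `SymbJoin.symGood_addRow` (p601464, same seat): the hypothesis «the new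
row is contained in no other row» is DROPPED; only injectivity of the row family remains.

**`SymbJoin.symGood_addRow_free`.** Let `(u, e)` have `r₀ + 1` distinct rows and columns. If column `k₀` is affinely free inside its
piece (cut constants `c` with `φ_c = 1` at its hidden set and `φ_c = 0` at the other hidden sets of the piece — e.g. a private state, or the
empty member of a star) and the configuration without row `i₀` and column `k₀` is generically good FOR SOME ROW `i₀`, then `(u, e)` is
generically good.

PROOF (the monomial-curve trick of val-np-p3 g9's `TwoLayer.symbGood_of_core_copy`, transplanted into the symbolic calculus). Shift the
piece's table along `c` by the CURVE `T^{2^a}` on coordinate `a` (`curveShift`): the hidden point of `k₀` moves by `T^{2^a}` in coordinate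
`a`, the other hidden points are fixed. Column `k₀` then has entries `∏_{a ∈ u i} (s_a + T^{2^a})`, monic of degree `E(u i) = Σ_{a ∈ u i} 2^a`
— pairwise DISTINCT degrees for distinct rows (binary expansion, `TwoLayer.binExp_injective`). Laplace along `k₀`: the term of row `i`
has degree `E(u i)` and leading coefficient `±` its minor. Take `i*` maximising `E(u i)` among the rows with NONZERO minor (row `i₀` is one):
the coefficient of `T^{E(u i*)}` in the shifted determinant is `± minor(i*) ≠ 0`.

CONSEQUENCE: «free points absorb arbitrary rows» needs no order bookkeeping at all — if a design is good for SOME `r₀`-row sub-family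
`u₀ ⊆ u`, the design enlarged by `|u ∖ u₀|` free points is good for `u`; see `…HiddenStatesCoreFreeStrong` (sequel) for the order-free
«tiled core ⊔ free points» theorem without the lower-set hypothesis.

WHAT THIS IS NOT: nothing about structured (non-free) columns; item 19717 OPEN; nothing on crux 14610 or VP ≠ VNP.
-/

set_option linter.dupNamespace false

namespace Summit.ValiantsHypothesis.ValiantsHypothesis.Theorems.BarrierLever.HiddenStates

open Finset Matrix MvPolynomial

noncomputable section

namespace SymbJoin

variable {h m K r : ℕ}

/-! ## 1. The curve shift of a piece's table -/

/-- The shift `X_{(p,o,a)} ↦ X_{(p,o,a)} + [p = p₀] · c(o) · T^{2^a}` (algebra homomorphism into the polynomial ring in `T`). -/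
def curveShift (p₀ : Fin m) (c : Option (Fin K) → ℂ) :
    MvPolynomial (Var m K h) ℂ →ₐ[ℂ] Polynomial (MvPolynomial (Var m K h) ℂ) :=
  MvPolynomial.aeval fun v : Var m K h =>
    Polynomial.C (X v) + (if v.1 = p₀ then Polynomial.C (C (c v.2.1)) * Polynomial.X ^ (2 ^ (v.2.2 : ℕ)) else 0)

/-- The curve shift moves coordinate `a` of the hidden point of a column of piece `p₀` by `φ_c(J) · T^{2^a}` and fixes other pieces. -/
theorem curveShift_symPoint (p₀ : Fin m) (c : Option (Fin K) → ℂ) (e : Fin r → Fin m × Finset (Fin K)) (k : Fin r) (a : Fin h) :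
    curveShift p₀ c (symPoint e k a) = Polynomial.C (symPoint e k a) +
      (if (e k).1 = p₀ then Polynomial.C (C (phi c (e k).2)) * Polynomial.X ^ (2 ^ (a : ℕ)) else 0) := by
  classical
  simp only [curveShift, symPoint, map_add, map_sum, MvPolynomial.aeval_X]
  by_cases hc : (e k).1 = p₀
  · simp only [hc, if_true, phi, map_add, map_sum, Finset.sum_add_distrib, add_mul, Finset.sum_mul]
    ring
  · simp only [hc, if_false, add_zero]

/-- A fixed column (another piece, or cut value `0`): constant entries. -/
theorem curveShift_entry_const (p₀ : Fin m) (c : Option (Fin K) → ℂ) (e : Fin r → Fin m × Finset (Fin K)) (k : Fin r)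
    (hk : (e k).1 = p₀ → phi c (e k).2 = 0) (U : Finset (Fin h)) :
    curveShift p₀ c (∏ a ∈ U, symPoint e k a) = Polynomial.C (∏ a ∈ U, symPoint e k a) := by
  classical
  rw [map_prod, map_prod]
  refine Finset.prod_congr rfl fun a _ => ?_
  rw [curveShift_symPoint]
  by_cases hp : (e k).1 = p₀
  · simp [hp, hk hp]
  · simp [hp]

/-- The moving column (cut value `1`): entry `∏_{a ∈ U} (T^{2^a} + s_a)`. -/
theorem curveShift_entry_new (p₀ : Fin m) (c : Option (Fin K) → ℂ) (e : Fin r → Fin m × Finset (Fin K)) (k : Fin r)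
    (hp : (e k).1 = p₀) (hk : phi c (e k).2 = 1) (U : Finset (Fin h)) :
    curveShift p₀ c (∏ a ∈ U, symPoint e k a) =
      ∏ a ∈ U, (Polynomial.X ^ (2 ^ (a : ℕ)) + Polynomial.C (symPoint e k a)) := by
  classical
  rw [map_prod]
  refine Finset.prod_congr rfl fun a _ => ?_
  rw [curveShift_symPoint, if_pos hp, hk, add_comm]
  simp

/-- The moving column's entry in row `U` is monic of degree `E(U) = Σ_{a ∈ U} 2^a`. -/
theorem monic_entry_new (U : Finset (Fin h)) (s : Fin h → MvPolynomial (Var m K h) ℂ) :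
    (∏ a ∈ U, (Polynomial.X ^ (2 ^ (a : ℕ)) + Polynomial.C (s a))).Monic ∧
    (∏ a ∈ U, (Polynomial.X ^ (2 ^ (a : ℕ)) + Polynomial.C (s a))).natDegree = ∑ a ∈ U, 2 ^ (a : ℕ) := by
  have hmon : ∀ a ∈ U, (Polynomial.X ^ (2 ^ (a : ℕ)) + Polynomial.C (s a)).Monic :=
    fun a _ => Polynomial.monic_X_pow_add_C _ (pow_ne_zero _ two_ne_zero)
  refine ⟨Polynomial.monic_prod_of_monic _ _ hmon, ?_⟩
  rw [Polynomial.natDegree_prod_of_monic _ _ hmon]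
  exact Finset.sum_congr rfl fun a _ => Polynomial.natDegree_X_pow_add_C

/-! ## 2. The strong add-row lemma -/

/-- **THE STRONG ADD-ROW LEMMA.** Distinct rows; column `k₀` affinely free inside its piece (`φ_c = 1` there, `0` on the other columns of
the piece); the configuration without row `i₀` and column `k₀` generically good for SOME `i₀`. Then the whole configuration is generically
good — with NO condition on how the row `u i₀` sits among the other rows. -/
theorem symGood_addRow_free {r₀ : ℕ} (u : Fin (r₀ + 1) → Finset (Fin h)) (hu : Function.Injective u)
    (e : Fin (r₀ + 1) → Fin m × Finset (Fin K)) (i₀ k₀ : Fin (r₀ + 1)) (c : Option (Fin K) → ℂ)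
    (hnew : phi c (e k₀).2 = 1)
    (hold : ∀ j : Fin r₀, (e (k₀.succAbove j)).1 = (e k₀).1 → phi c (e (k₀.succAbove j)).2 = 0)
    (h0 : symDet (fun j : Fin r₀ => u (i₀.succAbove j)) (fun j => e (k₀.succAbove j)) ≠ 0) :
    symDet u e ≠ 0 := by
  classical
  intro hD
  set Ψ := curveShift (m := m) (K := K) (h := h) (e k₀).1 c with hΨ
  set N : Matrix (Fin (r₀ + 1)) (Fin (r₀ + 1)) (Polynomial (MvPolynomial (Var m K h) ℂ)) :=
    Ψ.toRingHom.mapMatrix (symMat u e) with hN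
  have hdetN : N.det = 0 := by
    rw [hN, ← RingHom.map_det, show (symMat u e).det = symDet u e from rfl, hD, map_zero]
  have hNapply : ∀ i k, N i k = Ψ (∏ a ∈ u i, symPoint e k a) := by
    intro i k
    rw [hN, RingHom.mapMatrix_apply, Matrix.map_apply]
    rfl
  have hcolOld : ∀ i (j : Fin r₀), N i (k₀.succAbove j) = Polynomial.C (symMat u e i (k₀.succAbove j)) := by
    intro i j
    rw [hNapply, hΨ, curveShift_entry_const _ _ e _ (hold j)]
    rfl
  have hcolNew : ∀ i, N i k₀ = ∏ a ∈ u i, (Polynomial.X ^ (2 ^ (a : ℕ)) + Polynomial.C (symPoint e k₀ a)) := by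
    intro i
    rw [hNapply, hΨ, curveShift_entry_new _ _ e k₀ rfl hnew]
  -- minors along column k₀ are constants
  let mnr : Fin (r₀ + 1) → MvPolynomial (Var m K h) ℂ := fun i => ((symMat u e).submatrix i.succAbove k₀.succAbove).det
  have hminor : ∀ i : Fin (r₀ + 1), (N.submatrix i.succAbove k₀.succAbove).det = Polynomial.C (mnr i) := by
    intro i
    have : N.submatrix i.succAbove k₀.succAbove
        = (Polynomial.C : MvPolynomial (Var m K h) ℂ →+* _).mapMatrix ((symMat u e).submatrix i.succAbove k₀.succAbove) := by
      ext a b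
      rw [Matrix.submatrix_apply, hcolOld, RingHom.mapMatrix_apply, Matrix.map_apply, Matrix.submatrix_apply]
    rw [this, ← RingHom.map_det]
  have hmnr0 : mnr i₀ ≠ 0 := by
    change ((symMat u e).submatrix i₀.succAbove k₀.succAbove).det ≠ 0
    exact h0
  -- degrees E(u i), injective in i
  let E : Fin (r₀ + 1) → ℕ := fun i => ∑ a ∈ u i, 2 ^ (a : ℕ)
  have hE : Function.Injective E := fun i j hij => hu (TwoLayer.binExp_injective hij)
  have hdeg : ∀ i, (N i k₀).Monic ∧ (N i k₀).natDegree = E i := fun i => by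
    rw [hcolNew]; exact monic_entry_new (u i) fun a => symPoint e k₀ a
  -- the row of largest degree among those with nonzero minor
  set good : Finset (Fin (r₀ + 1)) := Finset.univ.filter fun i => mnr i ≠ 0 with hgood
  have hgood_ne : good.Nonempty := ⟨i₀, by rw [hgood, Finset.mem_filter]; exact ⟨Finset.mem_univ _, hmnr0⟩⟩
  obtain ⟨istar, histar, hmax⟩ := Finset.exists_max_image good E hgood_ne
  have hmnr_star : mnr istar ≠ 0 := by rw [hgood, Finset.mem_filter] at histar; exact histar.2
  -- Laplace expansion along k₀, coefficient of T^{E istar}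
  have hlap := Matrix.det_succ_column N k₀
  have hsign : ∀ n : ℕ, ((-1 : Polynomial (MvPolynomial (Var m K h) ℂ)) ^ n)
      = Polynomial.C ((-1 : MvPolynomial (Var m K h) ℂ) ^ n) := by
    intro n; rw [map_pow, map_neg, map_one]
  have hcoef : ∀ i : Fin (r₀ + 1), ((-1) ^ (i + k₀ : ℕ) * N i k₀ * (N.submatrix i.succAbove k₀.succAbove).det).coeff (E istar)
      = (-1) ^ (i + k₀ : ℕ) * (N i k₀).coeff (E istar) * mnr i := by
    intro i
    rw [hminor, Polynomial.coeff_mul_C, hsign, Polynomial.coeff_C_mul]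
  have hcoef_star : (N istar k₀).coeff (E istar) = 1 := by
    obtain ⟨hm, hd⟩ := hdeg istar
    rw [← hd]; exact hm.coeff_natDegree
  have hcoef_other : ∀ i, i ≠ istar → (-1) ^ (i + k₀ : ℕ) * (N i k₀).coeff (E istar) * mnr i = 0 := by
    intro i hi
    by_cases hm0 : mnr i = 0
    · rw [hm0, mul_zero]
    · have hlt : E i < E istar := by
        have hle : E i ≤ E istar := hmax i (by rw [hgood, Finset.mem_filter]; exact ⟨Finset.mem_univ _, hm0⟩)
        exact lt_of_le_of_ne hle fun heq => hi (hE heq)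
      rw [Polynomial.coeff_eq_zero_of_natDegree_lt (by rw [(hdeg i).2]; exact hlt), mul_zero, zero_mul]
  have key : (N.det).coeff (E istar) = (-1) ^ (istar + k₀ : ℕ) * mnr istar := by
    rw [hlap, Polynomial.finsetSum_coeff, Finset.sum_eq_single istar, hcoef, hcoef_star, mul_one]
    · intro i _ hi; rw [hcoef]; exact hcoef_other i hi
    · intro h; exact absurd (Finset.mem_univ _) h
  rw [hdetN, Polynomial.coeff_zero] at key
  have hunit : ((-1 : MvPolynomial (Var m K h) ℂ) ^ (istar + k₀ : ℕ)) ≠ 0 := pow_ne_zero _ (neg_ne_zero.mpr one_ne_zero)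
  exact (mul_ne_zero hunit hmnr_star) key.symm

/-- **Strong add-row lemma, private-state form.** -/
theorem symGood_addRow_free_private {r₀ : ℕ} (u : Fin (r₀ + 1) → Finset (Fin h)) (hu : Function.Injective u)
    (e : Fin (r₀ + 1) → Fin m × Finset (Fin K)) (i₀ k₀ : Fin (r₀ + 1)) (q : Fin K) (hq : q ∈ (e k₀).2)
    (hpriv : ∀ j : Fin r₀, (e (k₀.succAbove j)).1 = (e k₀).1 → q ∉ (e (k₀.succAbove j)).2)
    (h0 : symDet (fun j : Fin r₀ => u (i₀.succAbove j)) (fun j => e (k₀.succAbove j)) ≠ 0) :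
    symDet u e ≠ 0 := by
  classical
  refine symGood_addRow_free u hu e i₀ k₀ (fun o => Option.elim o 0 fun q' => if q' = q then 1 else 0) ?_ ?_ h0
  · simp [phi, Finset.sum_ite_eq', hq]
  · intro j hj
    simp [phi, Finset.sum_ite_eq', hpriv j hj]

/-! ## 3. Iteration and the order-free form without any row condition -/

/-- **Iterated strong add-row.** Rows/columns indexed by `Fin (r₀ + k)`, rows pairwise distinct: if the first `r₀` form a generically
good configuration and every later column is affinely free w.r.t. the EARLIER columns of its piece, the whole configuration is good. -/
theorem symGood_extend_free (r₀ : ℕ) : ∀ (k : ℕ) (u : Fin (r₀ + k) → Finset (Fin h)) (e : Fin (r₀ + k) → Fin m × Finset (Fin K)),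
    Function.Injective u →
    symDet (fun i : Fin r₀ => u (Fin.castAdd k i)) (fun i => e (Fin.castAdd k i)) ≠ 0 →
    (∀ j : Fin (r₀ + k), r₀ ≤ (j : ℕ) → ∃ c : Option (Fin K) → ℂ, phi c (e j).2 = 1 ∧
      ∀ i : Fin (r₀ + k), i < j → (e i).1 = (e j).1 → phi c (e i).2 = 0) →
    symDet u e ≠ 0
  | 0, u, e, _, h0, _ => by
    have hu : (fun i : Fin r₀ => u (Fin.castAdd 0 i)) = u := funext fun i => congrArg u (Fin.ext rfl)
    have he : (fun i : Fin r₀ => e (Fin.castAdd 0 i)) = e := funext fun i => congrArg e (Fin.ext rfl)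
    rwa [hu, he] at h0
  | k + 1, u, e, hu, h0, hphi => by
    classical
    have hlast : r₀ ≤ ((Fin.last (r₀ + k) : Fin (r₀ + (k + 1))) : ℕ) := by simp
    obtain ⟨c, hc1, hc0⟩ := hphi (Fin.last (r₀ + k)) hlast
    refine symGood_addRow_free (r₀ := r₀ + k) u hu e (Fin.last (r₀ + k)) (Fin.last (r₀ + k)) c hc1 ?_ ?_
    · intro j hj
      rw [Fin.succAbove_last] at hj ⊢
      exact hc0 _ (Fin.castSucc_lt_last j) hj
    · have IH := symGood_extend_free r₀ k (fun i => u (Fin.castSucc i)) (fun i => e (Fin.castSucc i))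
        (fun i j hij => Fin.castSucc_injective _ (hu hij)) ?_ ?_
      · simpa only [Fin.succAbove_last] using IH
      · have hu' : (fun i : Fin r₀ => u (Fin.castSucc (Fin.castAdd k i))) = fun i => u (Fin.castAdd (k + 1) i) :=
          funext fun i => congrArg u (castAdd_succ_eq i).symm
        have he' : (fun i : Fin r₀ => e (Fin.castSucc (Fin.castAdd k i))) = fun i => e (Fin.castAdd (k + 1) i) :=
          funext fun i => congrArg e (castAdd_succ_eq i).symm
        rw [hu', he']
        exact h0
      · intro j hj
        obtain ⟨c', hc'1, H⟩ := hphi (Fin.castSucc j) (by simpa using hj)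
        exact ⟨c', hc'1, fun i hij hp => H (Fin.castSucc i) (by simpa using hij) hp⟩

/-- **ORDER-FREE «GOOD CORE + FREE POINTS» THEOREM (no row condition).** Distinct rows `u`, any columns `e`; injections
`row, col : Fin r₀ → Fin r` such that the core configuration `(u ∘ row, e ∘ col)` is generically good; every non-core column affinely
free among the columns of its piece. Then `symDet u e ≠ 0`: the free points absorb the non-core rows WHATEVER they are. -/
theorem symGood_goodCore_free {r₀ : ℕ} (u : Fin r → Finset (Fin h)) (hu : Function.Injective u)
    (e : Fin r → Fin m × Finset (Fin K)) (row col : Fin r₀ → Fin r)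
    (hrow : Function.Injective row) (hcol : Function.Injective col)
    (hcore : symDet (fun c => u (row c)) (fun c => e (col c)) ≠ 0)
    (hfree : ∀ k, k ∉ Set.range col → ∃ c : Option (Fin K) → ℂ, phi c (e k).2 = 1 ∧
      ∀ k', k' ≠ k → (e k').1 = (e k).1 → phi c (e k').2 = 0) :
    symDet u e ≠ 0 := by
  classical
  have hr₀ : r₀ ≤ r := by simpa using Fintype.card_le_of_injective row hrow
  obtain ⟨kk, rfl⟩ : ∃ kk, r = r₀ + kk := ⟨r - r₀, by omega⟩
  -- non-core rows and columns, in any order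
  set Lc : Finset (Fin (r₀ + kk)) := Finset.univ \ Finset.univ.image col with hLc_def
  have hLc : Lc.card = kk := by
    rw [hLc_def, Finset.card_sdiff_of_subset (Finset.subset_univ _), Finset.card_univ, Fintype.card_fin,
      Finset.card_image_of_injective _ hcol, Finset.card_univ, Fintype.card_fin]
    omega
  set Lr : Finset (Fin (r₀ + kk)) := Finset.univ \ Finset.univ.image row with hLr_def
  have hLr : Lr.card = kk := by
    rw [hLr_def, Finset.card_sdiff_of_subset (Finset.subset_univ _), Finset.card_univ, Fintype.card_fin,
      Finset.card_image_of_injective _ hrow, Finset.card_univ, Fintype.card_fin]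
    omega
  let colL : Fin kk → Fin (r₀ + kk) := fun j => Lc.orderEmbOfFin hLc j
  let rowL : Fin kk → Fin (r₀ + kk) := fun j => Lr.orderEmbOfFin hLr j
  have hcolL_mem : ∀ j, colL j ∉ Set.range col := by
    intro j ⟨c, hc⟩
    have hm : colL j ∈ Lc := Finset.orderEmbOfFin_mem Lc hLc j
    rw [hLc_def, Finset.mem_sdiff] at hm
    exact hm.2 (Finset.mem_image.mpr ⟨c, Finset.mem_univ _, hc⟩)
  have hrowL_mem : ∀ j, rowL j ∉ Set.range row := by
    intro j ⟨c, hc⟩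
    have hm : rowL j ∈ Lr := Finset.orderEmbOfFin_mem Lr hLr j
    rw [hLr_def, Finset.mem_sdiff] at hm
    exact hm.2 (Finset.mem_image.mpr ⟨c, Finset.mem_univ _, hc⟩)
  have hcolL_inj : Function.Injective colL := fun a b hab => (Lc.orderEmbOfFin hLc).injective hab
  have hrowL_inj : Function.Injective rowL := fun a b hab => (Lr.orderEmbOfFin hLr).injective hab
  let fr : Fin (r₀ + kk) → Fin (r₀ + kk) := Fin.append row rowL
  let fc : Fin (r₀ + kk) → Fin (r₀ + kk) := Fin.append col colL
  have hfr : Function.Injective fr :=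
    Fin.append_injective_iff.mpr ⟨hrow, hrowL_inj, fun i j hij => hrowL_mem j ⟨i, hij⟩⟩
  have hfc : Function.Injective fc :=
    Fin.append_injective_iff.mpr ⟨hcol, hcolL_inj, fun i j hij => hcolL_mem j ⟨i, hij⟩⟩
  let er : Fin (r₀ + kk) ≃ Fin (r₀ + kk) := Equiv.ofBijective fr (Finite.injective_iff_bijective.mp hfr)
  let ec : Fin (r₀ + kk) ≃ Fin (r₀ + kk) := Equiv.ofBijective fc (Finite.injective_iff_bijective.mp hfc)
  have her_l : ∀ i : Fin r₀, er (Fin.castAdd kk i) = row i := fun i => Fin.append_left row rowL i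
  have hec_l : ∀ i : Fin r₀, ec (Fin.castAdd kk i) = col i := fun i => Fin.append_left col colL i
  have hec_r : ∀ j : Fin kk, ec (Fin.natAdd r₀ j) = colL j := fun j => Fin.append_right col colL j
  refine symGood_of_reindex u e er ec (symGood_extend_free r₀ kk (fun i => u (er i)) (fun k => e (ec k))
    (fun i j hij => er.injective (hu hij)) ?_ ?_)
  · have hu' : (fun i : Fin r₀ => u (er (Fin.castAdd kk i))) = fun i => u (row i) := funext fun i => by rw [her_l]
    have he' : (fun i : Fin r₀ => e (ec (Fin.castAdd kk i))) = fun i => e (col i) := funext fun i => by rw [hec_l]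
    rw [hu', he']
    exact hcore
  · intro j hj
    rcases eq_castAdd_or_natAdd j with ⟨j', rfl⟩ | ⟨j', rfl⟩
    · simp at hj; omega
    obtain ⟨c, hc1, hc0⟩ := hfree (ec (Fin.natAdd r₀ j')) (by rw [hec_r]; exact hcolL_mem j')
    exact ⟨c, hc1, fun i hij hp => hc0 (ec i) (fun heq => absurd (ec.injective heq) (ne_of_lt hij)) hp⟩

/-- **«TILED CORE ⊔ FREE POINTS», strong form.** As `symGood_core_free` (p602295) but WITHOUT the condition on non-core rows: the core
columns tile the core rows, the other columns are affinely free in their pieces, the rows are distinct — nothing else. -/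
theorem symGood_core_free' {r₀ : ℕ} (u : Fin r → Finset (Fin h)) (hu : Function.Injective u)
    (e : Fin r → Fin m × Finset (Fin K)) (row col : Fin r₀ → Fin r)
    (hrow : Function.Injective row) (hcol : Function.Injective col)
    (Cst : Fin m → Finset (Fin h)) (σ : Fin m → Fin K → Fin h)
    (htile : ∀ c a, a ∈ u (row c) ↔ a ∈ Cst (e (col c)).1 ∨ ∃ q ∈ (e (col c)).2, σ (e (col c)).1 q = a)
    (hfree : ∀ k, k ∉ Set.range col → ∃ c : Option (Fin K) → ℂ, phi c (e k).2 = 1 ∧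
      ∀ k', k' ≠ k → (e k').1 = (e k).1 → phi c (e k').2 = 0) :
    symDet u e ≠ 0 :=
  symGood_goodCore_free u hu e row col hrow hcol
    (symGood_of_tiling (fun c => u (row c)) (hu.comp hrow) (fun c => e (col c)) Cst σ htile) hfree

/-- The numeric form (`∃ tx, det ≠ 0`) of `symGood_goodCore_free`. -/
theorem exists_table_of_goodCore_free {r₀ : ℕ} (u : Fin r → Finset (Fin h)) (hu : Function.Injective u)
    (e : Fin r → Fin m × Finset (Fin K)) (row col : Fin r₀ → Fin r)
    (hrow : Function.Injective row) (hcol : Function.Injective col)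
    (hcore : symDet (fun c => u (row c)) (fun c => e (col c)) ≠ 0)
    (hfree : ∀ k, k ∉ Set.range col → ∃ c : Option (Fin K) → ℂ, phi c (e k).2 = 1 ∧
      ∀ k', k' ≠ k → (e k').1 = (e k).1 → phi c (e k').2 = 0) :
    ∃ tx : Fin m → Option (Fin K) → Fin h → ℂ,
      (Matrix.of fun i k : Fin r =>
        ∏ a ∈ u i, (tx (e k).1 none a + ∑ q ∈ (e k).2, tx (e k).1 (some q) a)).det ≠ 0 :=
  exists_table_of_symGood u e (symGood_goodCore_free u hu e row col hrow hcol hcore hfree)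

end SymbJoin

end

end Summit.ValiantsHypothesis.ValiantsHypothesis.Theorems.BarrierLever.HiddenStates
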